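import Summits.Ventures.HodgeRepro2.T6Interface
import Summits.Ventures.HodgeRepro2.T6InterfaceParity

/-!
# T6InterfaceToy — a kernel instance of `TransferShadow F` (non-vacuity witness for M1)

README §10.5(ii)(c),(d): the M1 theorem `theoremA_of_N` quantifies over `D : TransferShadow F`; this file
exhibits an instance for EVERY face setting `F` (`transferShadow_nonempty`), so the binder is instantiable
and its Prop fields are jointly satisfiable. The instance is the explicit exterior model itself:
`Alg k := H^{2k}(B, ℚ)` (every even class «algebraic»), `∫_B` := the top coefficient in a monomial basis
of `⋀ H¹` (degree `24`), `∫_{B×B} := ∫_B ⊗ ∫_B`, `m^*` := the shuffle coproduct `ι v ↦ ι v ⊗ 1 + 1 ⊗ ι v`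
(Koszul sign), `⋆` := the Poincaré dual of `u ↦ ∫_{B×B} (a ⊗ b) ∪ m^* u` (so `pont_spec` is the
definition and `alg_pont` is the degree bookkeeping `deg (a ⋆ b) = deg a + deg b - 24`), and the
«surface side» trivial: `HS := ℂ`, `pull` := the augmentation, `∫_S := 0`, `z := 0`. On this instance
`PeriodInputN` is FALSE (as it must be: the toy has no Weil class detected), and `WeilClassesAlgebraic`
is TRUE trivially — the toy witnesses satisfiability of the binder, not the theorem.
Layer III replaces it by the true `D` built from the host carriers (TARGET-T6.md §2).
v2: the bidegree bookkeeping (`bideg` / `bisum` / `cop_mem` / the vanishing lemmas) now comes from the generic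
`T6InterfaceParity` (p400597) instead of private copies.
§8(d): uses an L-value-free non-vanishing device: NO.
-/

namespace Summit.Ventures.HodgeRepro2.T6.Toy

open ExteriorAlgebra ExteriorDuality GradedTensorProduct Parity
open scoped TensorProduct

variable (K : Type*) [Field K] [NumberField K]

/-- A basis of `H¹(B, ℚ)` (any basis; only its index cardinality `24` is used). -/
noncomputable abbrev b1 :
    Module.Basis (Fin (Module.finrank ℚ (H1 K))) ℚ (H1 K) := Module.finBasis ℚ (H1 K)

variable {K}

/-- `dim H¹(B, ℚ) = 4 · 6 = 24` (`FaceSetting.deg6`). -/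
lemma finrank_H1 (F : FaceSetting K) : Module.finrank ℚ (H1 K) = 24 := by
  show Module.finrank ℚ (Fin 4 → K) = 24
  rw [Module.finrank_pi_fintype]
  simp [F.deg6]

/-- The index type of `b1` has `24` elements. -/
lemma card_index (F : FaceSetting K) : Fintype.card (Fin (Module.finrank ℚ (H1 K))) = 24 := by
  rw [Fintype.card_fin, finrank_H1 F]

variable (K) in
/-- Toy `∫_B` := the top coefficient in the monomial basis of `b1`. -/
noncomputable def intB : HB K →ₗ[ℚ] ℚ := topCoeff (b1 K)

/-- `intB_deg` for the toy: `∫_B` kills `H^k` for `k ≠ 24`. -/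
lemma intB_deg (F : FaceSetting K) : ∀ k ≠ 24, ∀ a ∈ degB K k, intB K a = 0 := fun k hk a ha =>
  topCoeff_of_mem_of_ne (b1 K) (by rw [card_index F]; exact hk) ha

/-- `intB_ne_zero` for the toy: `∫_B e_univ = 1`. -/
lemma intB_ne_zero (F : FaceSetting K) : ∃ a ∈ degB K 24, intB K a ≠ 0 := by
  have hmem : (b1 K).ExteriorAlgebra Finset.univ ∈ degB K 24 := by
    have hc : (Finset.univ : Finset (Fin (Module.finrank ℚ (H1 K)))).card = 24 := by
      rw [Finset.card_univ, card_index F]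
    exact hc ▸ basis_mem (b1 K) Finset.univ
  have hne : intB K ((b1 K).ExteriorAlgebra Finset.univ) ≠ 0 := by
    rw [intB, topCoeff_basis, if_pos rfl]
    exact one_ne_zero
  exact ⟨_, hmem, hne⟩

variable (K) in
/-- Toy `∫_{B×B}` := `∫_B ⊗ ∫_B` (Fubini on the Künneth model). -/
noncomputable def intBB : HBB K →ₗ[ℚ] ℚ :=
  TensorProduct.lift ((LinearMap.mul ℚ ℚ).compl₁₂ (intB K) (intB K)) ∘ₗ
    (of ℚ (fun i : ℕ => ⋀[ℚ]^i (H1 K)) (fun i : ℕ => ⋀[ℚ]^i (H1 K))).symm.toLinearMap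

/-- `∫_{B×B} (a ᵍ⊗ b) = ∫_B a · ∫_B b`. -/
lemma intBB_tmul' (a b : HB K) : intBB K (a ᵍ⊗ₜ b) = intB K a * intB K b := by
  simp [intBB, GradedTensorProduct.tmul]

/-- `intBB_tmul` for the toy (Fubini). -/
lemma intBB_tmul (a b : HB K) : intBB K (inl K a * inr K b) = intB K a * intB K b := by
  rw [inl_mul_inr, intBB_tmul']

variable (K) in
/-- `v ↦ ι v ⊗ 1 + 1 ⊗ ι v`, the degree-one part of the coproduct. -/
noncomputable def copGen : H1 K →ₗ[ℚ] HBB K :=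
  (inl K).toLinearMap ∘ₗ ExteriorAlgebra.ι ℚ + (inr K).toLinearMap ∘ₗ ExteriorAlgebra.ι ℚ

/-- `copGen v = ι v ⊗ 1 + 1 ⊗ ι v`. -/
lemma copGen_apply (v : H1 K) : copGen K v = inl K (ι ℚ v) + inr K (ι ℚ v) := rfl

/-- The Koszul sign makes `ι v ⊗ 1 + 1 ⊗ ι v` square to zero. -/
lemma copGen_sq (v : H1 K) : copGen K v * copGen K v = 0 := by
  rw [copGen_apply, add_mul, mul_add, mul_add, ← map_mul (inl K), ← map_mul (inr K), ι_sq_zero,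
    map_zero, map_zero]
  have h1 : inl K (ι ℚ v) * inr K (ι ℚ v) = (ι ℚ v) ᵍ⊗ₜ (ι ℚ v) := inl_mul_inr _ _
  have h2 : inr K (ι ℚ v) * inl K (ι ℚ v) = -((ι ℚ v) ᵍ⊗ₜ (ι ℚ v) : HBB K) := by
    rw [inl_apply, inr_apply]
    have h : ((1 : HB K) ᵍ⊗ₜ (ι ℚ v) : HBB K) * ((ι ℚ v) ᵍ⊗ₜ (1 : HB K)) =
        (-1 : ℤˣ) ^ (1 * 1) • (((1 : HB K) * ι ℚ v) ᵍ⊗ₜ (ι ℚ v * 1) : HBB K) :=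
      tmul_coe_mul_coe_tmul (fun i : ℕ => ⋀[ℚ]^i (H1 K)) (fun i : ℕ => ⋀[ℚ]^i (H1 K))
        (1 : HB K) ⟨ι ℚ v, ι_mem_one v⟩ ⟨ι ℚ v, ι_mem_one v⟩ (1 : HB K)
    rw [h]
    simp
  rw [h1, h2]
  simp

variable (K) in
/-- Toy `m^*`: the algebra map `⋀ H¹ → ⋀ H¹ ᵍ⊗ ⋀ H¹` with `ι v ↦ ι v ⊗ 1 + 1 ⊗ ι v`. -/
noncomputable def cop : HB K →ₐ[ℚ] HBB K :=
  ExteriorAlgebra.lift ℚ ⟨copGen K, copGen_sq⟩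

/-- `cop_ι` for the toy: `m^* (ι v) = ι v ⊗ 1 + 1 ⊗ ι v`. -/
lemma cop_ι (v : H1 K) : cop K (ι ℚ v) = inl K (ι ℚ v) + inr K (ι ℚ v) := by
  rw [cop, ExteriorAlgebra.lift_ι_apply]
  rfl

variable (K) in
/-- `Ψ a b : u ↦ ∫_{B×B} (a ⊗ b) ∪ m^* u`, bilinear in `(a, b)`. -/
noncomputable def psi :
    HB K →ₗ[ℚ] HB K →ₗ[ℚ] Module.Dual ℚ (HB K) :=
  ((LinearMap.mul ℚ (HBB K)).compl₁₂ (inl K).toLinearMap (inr K).toLinearMap).compr₂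
    (((LinearMap.mul ℚ (HBB K)).compl₂ (cop K).toLinearMap).compr₂ (intBB K))

/-- `Ψ a b u = ∫_{B×B} (pr_1^* a ∪ pr_2^* b) ∪ m^* u`. -/
lemma psi_apply (a b u : HB K) : psi K a b u = intBB K (inl K a * inr K b * cop K u) := rfl

variable (K) in
/-- Toy Pontryagin product: `a ⋆ b` := the Poincaré dual of `Ψ a b`. -/
noncomputable def pont : HB K →ₗ[ℚ] HB K →ₗ[ℚ] HB K :=
  (psi K).compr₂ (pairingEquiv (b1 K)).symm.toLinearMap

/-- `a ⋆ b` is the Poincaré dual of `Ψ a b`. -/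
lemma pont_apply (a b : HB K) : pont K a b = (pairingEquiv (b1 K)).symm (psi K a b) := rfl

/-- `pont_spec` for the toy: `∫_B (a ⋆ b) ∪ u = ∫_{B×B} (pr_1^* a ∪ pr_2^* b) ∪ m^* u` (by construction). -/
lemma pont_spec (a b u : HB K) :
    intB K (pont K a b * u) = intBB K (inl K a * inr K b * cop K u) := by
  rw [pont_apply, intB, topCoeff_pairingEquiv_symm_mul, psi_apply]

/-- Degree bookkeeping of the toy Pontryagin product: `deg (a ⋆ b) = deg a + deg b - 24`. -/
lemma pont_mem (F : FaceSetting K) {k l : ℕ} {a b : HB K} (ha : a ∈ degB K (2 * k))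
    (hb : b ∈ degB K (2 * l)) : pont K a b ∈ degB K (2 * (k + l - 12)) := by
  rw [pont_apply]
  by_cases hkl : 2 * k ≤ 24 ∧ 2 * l ≤ 24
  · have := pairingEquiv_symm_mem (b1 K) (psi K a b) (48 - 2 * k - 2 * l) ?_
    · rw [card_index F] at this
      have heq : 24 - (48 - 2 * k - 2 * l) = 2 * (k + l - 12) := by omega
      rwa [heq] at this
    · intro j hj u hu
      rw [psi_apply]
      exact intBB_inl_mul_inr_mul_cop_eq_zero (intB K) (intB_deg F) (intBB K) intBB_tmul (cop K) cop_ι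
        ha hb hu (by omega)
  · have h0 : psi K a b = 0 := by
      apply eq_zero_of_forall_comp
      intro j u hu
      rw [psi_apply]
      exact intBB_inl_mul_inr_mul_cop_eq_zero (intB K) (intB_deg F) (intBB K) intBB_tmul (cop K) cop_ι
        ha hb hu (by omega)
    rw [h0, map_zero]
    exact Submodule.zero_mem _

/-- THE TOY TRANSFER SHADOW: `Alg k := H^{2k}`, `∫_B` := top coefficient, `∫_{B×B} := ∫_B ⊗ ∫_B`,
`m^*` the shuffle coproduct, `⋆` its Poincaré dual, `S` trivial (`∫_S := 0`, `z := 0`). -/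
noncomputable def toyShadow (F : FaceSetting K) : TransferShadow F where
  Alg k := degB K (2 * k)
  alg_deg _ := le_rfl
  alg_one := one_mem_zero
  alg_mul := fun {k l a b} ha hb => by
    have := mul_mem_exteriorPower ha hb
    rwa [show 2 * k + 2 * l = 2 * (k + l) by ring] at this
  alg_pull := fun x {k} {a} ha =>
    map_mem_exteriorPower_of_ι (pullEndo K x)
      (fun v => by rw [pullEndo, ExteriorAlgebra.lift_ι_apply]; exact ι_mem_one _) ha
  alg_lefschetz := fun _ ha _ => ha
  intB := intB K
  intB_deg := intB_deg F
  intB_ne_zero := intB_ne_zero F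
  intBB := intBB K
  intBB_tmul := intBB_tmul
  cop := cop K
  cop_ι := cop_ι
  pont := pont K
  pont_spec := pont_spec
  alg_pont := fun {k l a b} ha hb => pont_mem F ha hb
  HS := ℂ
  pull := ExteriorAlgebra.algebraMapInv
  intS := 0
  z := 0
  z_deg := Submodule.zero_mem _
  z_alg := Submodule.zero_mem _
  z_proj := fun u => by simp

/-- NON-VACUITY WITNESS (README §10.5(ii)(c),(d)): the binder `D : TransferShadow F` of the M1 theorem
is instantiable for every face setting. -/
theorem transferShadow_nonempty (F : FaceSetting K) : Nonempty (TransferShadow F) :=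
  ⟨toyShadow F⟩

end Summit.Ventures.HodgeRepro2.T6.Toy
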